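import Summits.HubbardSuperconductivity.HubbardSuperconductivity.Theses.CooperPairDMottWalk
import Literature.MathematicalPhysics.QuantumLattice.PlaquetteBreathingSelfDuality

/-!
# Route `CooperPairDMottWalk`: support `BreathingSelfDualFourLe`
(stmt-HubbardSuperconductivity-15176)

The repaired self-duality of the breathing (plaquette / checkerboard) Hubbard family on the
`L × L` fermionic torus, `L` even and `4 ≤ L`: the diagonal translation `x ↦ x + (1,1)` maps the
plaquette tiling `{2m, 2m+1}²` onto the complementary tiling, hence swaps intra- and
inter-plaquette bonds, and the induced translation unitary `W = U_{(1,1)}` on Fock space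
conjugates `H_L(a,b,U)` to `H_L(b,a,U)` while commuting with `N`, `S^z` and the
translation-invariant `d`-wave pair field.

This is exactly `Literature.MathematicalPhysics.QuantumLattice.breathingSelfDual_of_four_le`
(file `Literature/MathematicalPhysics/QuantumLattice/PlaquetteBreathingSelfDuality.lean`); the
present file is the one-line wrapper closing the route item by name.

Sources: route card cooper-theorem-breathing-self-dual (Yao–Tsai–Kivelson 2007); the proof is
elementary bookkeeping (folklore). No definition is introduced.
-/

set_option linter.dupNamespace false

namespace Summit.HubbardSuperconductivity.HubbardSuperconductivity.Theorems.CooperPairDMottWalk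

open Literature.MathematicalPhysics.QuantumLattice
open Summit.HubbardSuperconductivity.HubbardSuperconductivity.Theses.CooperPairDMottWalk

/-- **`BreathingSelfDualFourLe` holds** (route `CooperPairDMottWalk`, support item
`stmt-HubbardSuperconductivity-15176`): for even `L ≥ 4` the translation unitary `U_{(1,1)}`
conjugates the breathing Hamiltonian `H_L(a,b,U)` to `H_L(b,a,U)` and commutes with `N`, `S^z`
and the `d`-wave pair field. Wrapper around
`Literature.MathematicalPhysics.QuantumLattice.breathingSelfDual_of_four_le`. [folklore] -/
theorem breathingSelfDualFourLe_proof : BreathingSelfDualFourLe := by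
  unfold BreathingSelfDualFourLe
  exact breathingSelfDual_of_four_le

end Summit.HubbardSuperconductivity.HubbardSuperconductivity.Theorems.CooperPairDMottWalk
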